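import Summits.BirchSwinnertonDyer.BirchSwinnertonDyer.Theorems.ThetaPartnerAtTwoSignedMainConjectureCMTwoRankZeroPTDeepTransferTools
import Summits.BirchSwinnertonDyer.BirchSwinnertonDyer.Theorems.ThetaPartnerAtTwoSignedMainConjectureCMTwoRankZeroPTDeepAdmissibleTransport
import Summits.BirchSwinnertonDyer.BirchSwinnertonDyer.Theorems.ThetaPartnerAtTwoSignedMainConjectureCMTwoRankZeroPTDeepLocalTransport
import HarnessLib

/-!
# Greenberg LNM 1716 Lemma 4.6 on `Γ`-invariants (H46), kernel road C′, brick B5 (places `≠ p, v₀`): from the levelwise Poitou–Tate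
# OUTPUT (B4) to the H46 REALISER over `K_∞` — Kummer condition of EVERY conjugate at the STRICT places, at `∞`, and at the
# GOOD places outside `S`

Cell `bsd-2adic` (run/shared/lean/pub/bsd-2adic/), seat `bsd-2adic-tower-1` GEN 34; `--supports stmt-BirchSwinnertonDyer-19271` (helper).
THEOREMS ONLY (no definition, no named fact, no instance declaration, no `sorry`); closes no item; nothing booked; BSD is not
proved by any of this. B4 (`…TorsionEulerCharH46Levelwise`, `M = E[p^k]`) outputs a layer class `c ∈ H¹(Γ_n, E[p^k])`
(`W.torsionH1Over ((p : ℤ) ^ k) (κ.layerSubgroup n)`) with `loc_v (Sh c) = 0` at the strict places `v ∈ S ∖ Sp` and at `∞`, and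
`loc_w (Sh c)` unramified at the finite `w ∉ S ∪ S₀`. The H46 REALISER is

  `T(c) := h_n (push c) = res_{Γ_n → Γ_∞} ((E[p^k] ↪ E[p^∞])_* c) ∈ W.subgroupH1 p κ.kerSubgroup`,

`push` in the spelling of the tree's TP2 tools (`SignedLowerOffTwo.PTDeep.conjH1_push`, `…PTDeepTransferTools`:
`resH1Hom (subgroupInclusion le_rfl) (AddSubgroup.inclusion (AcSigned.geomTorsion_zpow_le_geomPrimaryTorsion W p k)) _`), `h_n = W.layerToInfty κ n`.
This file is PURE ASSEMBLY of tree theorems (every number field `K`; the good-place clause for the CYCLOTOMIC `κ`):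

* `conjH1_realiser_mem_localKerOver_of_localization_shapiroLift_eq_zero` — FINITE strict `v`: `loc_v (Sh c) = 0 ⟹ ∀ σ, conj_σ T(c) ∈
  W.localKerOver p κ.kerSubgroup K_v` ((E1b) `resOfLe_decomp_conjH1_eq_zero_of_localization_shapiroLift_eq_zero` ↦
  `conjH1_push_mem_localKerOver_of_resOfLe_decomp_eq_zero` ↦ `layerToInfty_conjH1` + `resOfLe_mem_localKerOver`).
* `conjH1_realiser_mem_localKerOver_completion_of_localization_shapiroLift_eq_zero` — INFINITE `w`: the same with (E1c) and
  `conjH1_push_mem_localKerOver_infinitePlace_of_resOfLe_decompInf_eq_zero`.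
* `conjH1_realiser_mem_localKerOver_of_localization_shapiroLift_mem_unramified` — GOOD `w ∉ S`, `w ∤ p`, `κ` CYCLOTOMIC: `loc_w (Sh c)`
  unramified ⟹ `∀ σ, conj_σ T(c) ∈ W.localKerOver p κ.kerSubgroup K_w` ((E1a) `resLe_inertia_eq_zero_of_localization_shapiroLift_mem` at every
  `𝔓 ∣ w` ↦ `resOfLe_kerSubgroup_inertia_conjH1_push_eq_zero` ↦ Greenberg p. 70 «unramified ⟹ locally trivial over `K_∞` at `w ∤ p`»
  `conjH1_mem_localKerOver_layer_of_resOfLe_inertia_eq_zero_of_isCyclotomic` ↦ `K_∞`).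

These are clauses (i) (places of `S ∖ {p}` and good places) and (ii) (`∞`) of `Greenberg1999.lemma46_gammaInvariants_auxPlace_rat` for the realiser;
the value clause (iii) above `v₀` and the clause at `p` (Greenberg's condition, Prop. 2.4) are the sequels.

References: [GreenbergLNM1716] §4 Lemma 4.6 (p. 105), §2 (p. 70, local conditions), §3 Lemma 3.3 (p. 86); [SerreGaloisCohomology1997] I §2.5;
[NeukirchSchmidtWingberg2008] I §6 (1.6.4).
-/

set_option autoImplicit false
-- the Theorems namespace of this sub repeats the summit name by design (D-0017 nested layout)
set_option linter.dupNamespace false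

noncomputable section

open scoped Classical NumberField

universe u

namespace Summit.BirchSwinnertonDyer.BirchSwinnertonDyer.Theorems

namespace TorsionEulerChar.H46Realiser

open CategoryTheory Field NumberField IsDedekindDomain
  Literature.NumberTheory.GaloisRepresentations Literature.NumberTheory.GaloisRepresentations.DiscreteGaloisModule
  Literature.NumberTheory.EllipticCurves Literature.NumberTheory.EllipticCurves.GreenbergSelmer ZpExtension
open SignedLowerOffTwo.PTDeep

variable {K : Type u} [Field K] [NumberField K] (W : WeierstrassCurve K) (p : ℕ) [Fact p.Prime]
  (κ : ZpExtension K p) (n k : ℕ) [Fintype (absoluteGaloisGroup K ⧸ κ.layerSubgroup n)]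
  {s : absoluteGaloisGroup K ⧸ κ.layerSubgroup n → absoluteGaloisGroup K}
  (hs : ∀ x : absoluteGaloisGroup K ⧸ κ.layerSubgroup n, (s x : absoluteGaloisGroup K ⧸ κ.layerSubgroup n) = x)
  (hs1 : s ((1 : absoluteGaloisGroup K) : absoluteGaloisGroup K ⧸ κ.layerSubgroup n) = 1)

/-- **H46 clause (i) at a STRICT finite place.** If the localisation at the finite place `v` of the Shapiro lift of the layer class
`c ∈ H¹(Γ_n, E[p^k])` vanishes (`loc_v (Sh c) = 0` — B4's output at `v ∈ S ∖ Sp`), then EVERY conjugate `conj_σ T(c)` of the realiser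
`T(c) = h_n (push c) ∈ H¹(Γ_∞, E[p^∞])` satisfies the Kummer condition at `v`: `conj_σ T(c) ∈ W.localKerOver p κ.kerSubgroup K_v`.
[cite: GreenbergLNM1716, §4 Lemma 4.6 (p. 105), §2] [cite: SerreGaloisCohomology1997, I §2.5] -/
theorem conjH1_realiser_mem_localKerOver_of_localization_shapiroLift_eq_zero (v : HeightOneSpectrum (𝓞 K))
    (c : W.torsionH1Over ((p : ℤ) ^ k) (κ.layerSubgroup n))
    (h0 : galoisCohomology.localization ((W.torsionGaloisModule ((p : ℤ) ^ k)).coind (κ.layerSubgroup n) (κ.isOpen_layerSubgroup n))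
        (Sum.inr v) 1
      (shapiroLift (W.torsionGaloisModule ((p : ℤ) ^ k)).toTopRep (κ.layerSubgroup n) (κ.isOpen_layerSubgroup n) hs hs1 c) = 0)
    (σ : absoluteGaloisGroup K) :
    W.conjH1 p κ.kerSubgroup σ (W.layerToInfty κ n
        (resH1Hom (N := W.geomPrimaryTorsion p) (subgroupInclusion (le_refl (κ.layerSubgroup n)))
          (AddSubgroup.inclusion (AcSigned.geomTorsion_zpow_le_geomPrimaryTorsion W p k)) (fun _ _ ↦ rfl) c)) ∈
      W.localKerOver p κ.kerSubgroup (v.adicCompletion K) := by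
  rw [← W.layerToInfty_conjH1 κ]
  exact W.resOfLe_mem_localKerOver p (v.adicCompletion K) (κ.kerSubgroup_le_layerSubgroup n)
    (conjH1_push_mem_localKerOver_of_resOfLe_decomp_eq_zero W p κ v c σ
      (resOfLe_decomp_conjH1_eq_zero_of_localization_shapiroLift_eq_zero W ((p : ℤ) ^ k) κ n hs hs1 v c h0 σ))

/-- **H46 clause (ii) at an INFINITE place.** If `loc_w (Sh c) = 0` at the infinite place `w` (B4's output at `∞`), then
`conj_σ T(c) ∈ W.localKerOver p κ.kerSubgroup K_w` for every `σ ∈ Γ_K`.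
[cite: GreenbergLNM1716, §4 Lemma 4.6 (p. 105) and Remark (p. 106)] [cite: SerreGaloisCohomology1997, I §2.5] -/
theorem conjH1_realiser_mem_localKerOver_completion_of_localization_shapiroLift_eq_zero (w : InfinitePlace K)
    (c : W.torsionH1Over ((p : ℤ) ^ k) (κ.layerSubgroup n))
    (h0 : galoisCohomology.localization ((W.torsionGaloisModule ((p : ℤ) ^ k)).coind (κ.layerSubgroup n) (κ.isOpen_layerSubgroup n))
        (Sum.inl w) 1
      (shapiroLift (W.torsionGaloisModule ((p : ℤ) ^ k)).toTopRep (κ.layerSubgroup n) (κ.isOpen_layerSubgroup n) hs hs1 c) = 0)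
    (σ : absoluteGaloisGroup K) :
    W.conjH1 p κ.kerSubgroup σ (W.layerToInfty κ n
        (resH1Hom (N := W.geomPrimaryTorsion p) (subgroupInclusion (le_refl (κ.layerSubgroup n)))
          (AddSubgroup.inclusion (AcSigned.geomTorsion_zpow_le_geomPrimaryTorsion W p k)) (fun _ _ ↦ rfl) c)) ∈
      W.localKerOver p κ.kerSubgroup w.Completion := by
  rw [← W.layerToInfty_conjH1 κ]
  exact W.resOfLe_mem_localKerOver p w.Completion (κ.kerSubgroup_le_layerSubgroup n)
    (conjH1_push_mem_localKerOver_infinitePlace_of_resOfLe_decompInf_eq_zero W p κ w c σ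
      (resOfLe_decompInf_conjH1_eq_zero_of_localization_shapiroLift_eq_zero W ((p : ℤ) ^ k) κ n hs hs1 w c h0 σ))

/-- **H46 clause (i) at a GOOD place `w ∉ S`, `w ∤ p`, cyclotomic tower.** If `E[p^k]` is unramified at `w` and `Maps(Γ_K ⧸ Γ_n, E[p^k])` too
(e.g. `w` good, `w ∤ p`: `isUnramifiedAt_coind_torsionGaloisModule_layerSubgroup`), and the localisation of the Shapiro lift of `c` at `w` is
UNRAMIFIED (B4's output outside `S ∪ S₀`), then `conj_σ T(c) ∈ W.localKerOver p κ.kerSubgroup K_w` for every `σ ∈ Γ_K` — (E1a) at every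
prime `𝔓 ∣ w`, the TP2 transfer `resOfLe_kerSubgroup_inertia_conjH1_push_eq_zero`, and Greenberg's «unramified ⟹ locally trivial over `K_∞`
at `w ∤ p`» (`Gal((K_∞)_η^{unr}/(K_∞)_η)` has profinite order prime to `p`; tree `conjH1_mem_localKerOver_layer_of_resOfLe_inertia_eq_zero_of_isCyclotomic`).
[cite: GreenbergLNM1716, §2 (p. 70), §3 Lemma 3.3 (p. 86), §4 Lemma 4.6 (p. 105)] -/
theorem conjH1_realiser_mem_localKerOver_of_localization_shapiroLift_mem_unramified {K : Type} [Field K] [NumberField K]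
    (W : WeierstrassCurve K) [W.IsElliptic] (p : ℕ) [Fact p.Prime] (κ : ZpExtension K p) (hκ : κ.IsCyclotomic) (n k : ℕ)
    [Fintype (absoluteGaloisGroup K ⧸ κ.layerSubgroup n)] {s : absoluteGaloisGroup K ⧸ κ.layerSubgroup n → absoluteGaloisGroup K}
    (hs : ∀ x : absoluteGaloisGroup K ⧸ κ.layerSubgroup n, (s x : absoluteGaloisGroup K ⧸ κ.layerSubgroup n) = x)
    (hs1 : s ((1 : absoluteGaloisGroup K) : absoluteGaloisGroup K ⧸ κ.layerSubgroup n) = 1)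
    (w : HeightOneSpectrum (𝓞 K)) (hpw : (p : 𝓞 K) ∉ w.asIdeal) (hgood : W.HasGoodReductionAt w)
    (hunr : GaloisRep.IsUnramifiedAt w
      ((W.torsionGaloisModule ((p : ℤ) ^ k)).coind (κ.layerSubgroup n) (κ.isOpen_layerSubgroup n)))
    (c : W.torsionH1Over ((p : ℤ) ^ k) (κ.layerSubgroup n))
    (hc : galoisCohomology.localization ((W.torsionGaloisModule ((p : ℤ) ^ k)).coind (κ.layerSubgroup n) (κ.isOpen_layerSubgroup n))
        (Sum.inr w) 1
        (shapiroLift (W.torsionGaloisModule ((p : ℤ) ^ k)).toTopRep (κ.layerSubgroup n) (κ.isOpen_layerSubgroup n) hs hs1 c) ∈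
      unramifiedSubgroup (GaloisRep.toLocal w
        ((W.torsionGaloisModule ((p : ℤ) ^ k)).coind (κ.layerSubgroup n) (κ.isOpen_layerSubgroup n))) 1)
    (σ : absoluteGaloisGroup K) :
    W.conjH1 p κ.kerSubgroup σ (W.layerToInfty κ n
        (resH1Hom (N := W.geomPrimaryTorsion p) (subgroupInclusion (le_refl (κ.layerSubgroup n)))
          (AddSubgroup.inclusion (AcSigned.geomTorsion_zpow_le_geomPrimaryTorsion W p k)) (fun _ _ ↦ rfl) c)) ∈
      W.localKerOver p κ.kerSubgroup (w.adicCompletion K) := by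
  -- (E1a): `c` dies on `Γ_n ⊓ I_𝔓` for every `𝔓 ∣ w`
  have hadm : ∀ 𝔓 ∈ w.primesAbove, resLe (W.torsionGaloisModule ((p : ℤ) ^ k)).toTopRep
      (inf_le_left : κ.layerSubgroup n ⊓ 𝔓.inertia (absoluteGaloisGroup K) ≤ κ.layerSubgroup n) 1 c = 0 :=
    fun 𝔓 h𝔓 ↦ resLe_inertia_eq_zero_of_localization_shapiroLift_mem (W.torsionGaloisModule ((p : ℤ) ^ k)) (κ.layerSubgroup n)
      (κ.isOpen_layerSubgroup n) hs hs1 hunr c hc h𝔓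
  -- transfer: `conj_σ (h_n (push c))` dies on `Gal(K̄/K_∞) ⊓ I_w`, hence `conj_σ (push c)` is Kummer at `w` over `K_n`, then restrict
  have hur := resOfLe_kerSubgroup_inertia_conjH1_push_eq_zero W p κ w c hadm σ
  rw [← W.layerToInfty_conjH1 κ]
  exact W.resOfLe_mem_localKerOver p (w.adicCompletion K) (κ.kerSubgroup_le_layerSubgroup n)
    (conjH1_mem_localKerOver_layer_of_resOfLe_inertia_eq_zero_of_isCyclotomic w κ W hκ hpw hgood _ σ hur)

end TorsionEulerChar.H46Realiser

end Summit.BirchSwinnertonDyer.BirchSwinnertonDyer.Theorems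

end
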